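import Mathlib

/-!
# `Balaban1983to89.B11GlobalMin` — [Balaban1985Variational] Theorem 1: «there exists a minimal orbit in the space (8)»
— the LOCAL-vs-GLOBAL residual (cell GAPS G-B11-E5 / G-B11-E5R, DIVERGENCE D-B11-2), LOCATED as one unprinted
convexity lemma on the chart of Sects. B–D

CITATION HEADER (lean-in-tree rule 2026-08-18).  Source: T. Bałaban, *The variational problem and background fields in
renormalization group method for lattice gauge theories*, Commun. Math. Phys. **102**, 277–309 (1985),
doi:10.1007/bf01229381 (cell paper B11; held `paper:balaban1985-cmp102-variational-background`; journal page = PDF page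
+ 276; quotations from the page renders p. 277, 279–281, 289, 294, 299, 308 [PDF 1, 3–5, 13, 18, 23, 32] and the cell
transcript `HOME/b2b-balaban-b11/transcript.md` ll. 25–45, 70, 79, 86).  v1.1 (DOCFIX, cell GAPS C-ref6-2 / REFEREE6.md
E2): Prop. 3 constant corrected to the printed «ε₂ ≦ ¼ε₃», ε₃ = 4ε₂ (114); p. 299 quotation completed; every
declaration byte-identical to v1.  References of the paper used: [5] = [Balaban1985BackgroundPropagators]
(Thm 3.11, tree `B9.Thm311Printed`), [6] = [Balaban1985RegularSpaces] (Thm 2, tree `B8.Thm2Printed`).  Mathlib-only;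
modifies nothing in `…B11`, `…B11Thm1`, `…B11SectG`.  Cell record: `HOME/b2b-balaban-b11/GLOBAL-MIN.md` (GAPS G-B11-E5g).

THE PRINTED CLAIMS.  Abstract, p. 277: *"there exists a minimum of this action, unique up to these gauge
transformations"*; Theorem 1, p. 279: *"there exists a minimal orbit in the space 𝔘_k({Ω_j}, B₃ε₁) ∩ 𝔅_k(𝔅_k, V). (8)
This orbit is a unique critical orbit in the space (6) if B₃ε₁ ≤ ε₀ and ε₀ ≤ a₀."*; p. 281: *"We will prove that for
ε₁, ε₂ sufficiently small there exists exactly one critical configuration, which is a minimum of the functional (5)."*;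
THE PRINTED PROOF of minimality, p. 299: *"Thus the expansion (81) for this functional has the form 𝔉(A′) = A(U_k)
+ ½⟨A′, Δ₁A′⟩ + V(A′). (142) A second order differential at A′ = 0 is given by the quadratic form above, and it is
positive definite. Hence A′ = 0 is a minimum of the functional (143) and this implies that U_k is a minimal
configuration of the functional A(U)."* (the printed «(143)» is a print slip for (142) — the real (143) is the
regularity equation on p. 300 — cell DIVERGENCE D-B11-5) — a STRICT LOCAL minimum (positive second differential
at the unique critical point; positivity = [5] Thm 3.11 by reference, cell GAPS G-B11-E5R).  Minimality of A over the
whole space (6) (or (8)), the reading of «minimal orbit in the space (8)», is argued nowhere (G-B11-E5R: *"would need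
e.g. convexity of 𝔉 on the whole chart (77) … plus the fact that (6) is covered by the chart, neither of which is
stated"*).

THE LOCATED REDUCTION (this module types it; `globalMin_of_chart`).  (a) COVERAGE IS IN PRINT: p. 280–281 —
*"Configurations U from the space (18), and U₀, satisfy the assumptions (1.33)–(1.35) of this theorem [[6] Thm 2] with
α₀ = ε₀, α₁ = C₁ε₁ … for an arbitrary configuration U = U′U₀ from (18) there exists exactly one gauge transformation u
… such that U₁ = U′^{u^{−1}} satisfies the conditions (1.36)–(1.39) of [6]. These gauge transformations define a mapping
of the space (18) into a space of gauge field configurations U₁U₀ with U₁ satisfying the conditions (19) … (20) … (21),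
with ε₂ ≥ B₁(ε₀ + C₁ε₁). … The above mapping is one-to-one, hence using again the gauge invariance of the functional (5),
we have reduced …"* — together with Proposition 3, p. 289: *"The range of this transformation [(47), A = A′ − HD(A′)]
contains the set (43) with ε₂ ≦ ¼ε₃"* and the choice (113)–(114), p. 294: *"ε₂ ≦ ¼ε₃, (113) … ε₂ = B₁(ε₀ + C₁ε₁),
ε₃ = 4ε₂ = 4B₁(ε₀ + C₁ε₁). (114)"*: every orbit of (6) has a representative e^{iη(A′ − HD(A′))}U₀ with A′ in the
chart K = {(75), (76), (77)} (ε₃ = 4ε₂ = 4B₁(ε₀ + C₁ε₁)) and the same action 𝔉(A′) ((74)).  K is CONVEX ((75) affine, (76) linear, (77)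
sup-norm balls).  (b) On a convex set a local minimum of a CONVEX function is a global minimum (Mathlib
`IsMinOn.of_isLocalMinOn_of_convexOn`).  Hence: [𝔉 convex on K] ⇒ U_k minimises A over all of (6) ⊇ (8).
(c) THE MISSING LEMMA, printed nowhere in [Balaban1985Variational] or its references (typed as the hypothesis
`ChartConvex`; informal content = (ML) of GLOBAL-MIN.md §3): an L²-FORM bound for the Hessian of V on the chart,
|⟨𝔄, (δ²V/δA′²)(A′)𝔄⟩| ≤ θ_V(‖∇^η_{U₀}𝔄‖₂² + (L^jη)^{−2}‖𝔄‖₂²) for A′ in (77) and 𝔄 in T = {Q𝔄 = 0, RD*𝔄 = 0}, with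
θ_V = O(1)(ε₃ + C₁B₃ε₁) INDEPENDENT OF THE VOLUME, which with the L² gap of Δ₁ on T ([5] Thm 3.11 made quantitative
by the Schur test on the kernel bound (3.42) of G = Δ_a^{−1}: ⟨𝔄, Δ₁𝔄⟩ ≥ (O(1)B₀)^{−1}(L^jη)^{−2}‖𝔄‖₂² on T) and the
gradient form of Δ₁ ((31)–(34), (38)) gives Hess 𝔉(A′) > 0 on T for all A′ ∈ K, i.e. strict convexity of 𝔉 on K.  The
paper's bounds on δ²V/δA′² — (186) *"|((δ²/δA′²)V)(A′)𝔄|_{(−3)} ≤ 4C₄ε₃ max{|𝔄|_{(−1)}, |∇𝔄|_{(−2)}}"* and (189) —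
are BLOCK-SUP operator bounds; tested against lattice deltas they give L² (Schur) constants carrying the block volume
L^{jd}, and [4] Prop. 4 + Cauchy gives |C″[𝔄, 𝔄]| ≤ 2C₂(Σ_b|𝔄_b|)², an ℓ¹-squared bound, off from ℓ² by the number of
bonds in B^k(c₋)∪B^k(c₊); so (ML) is NOT a corollary of the printed estimates and needs the explicit second-order
structure of the averaging nonlinearities (BCH pair structure along contours) — plausible, about a page, unprinted.
Value = typed reduction isolating exactly one unprinted lemma, NOT summit progress.
-/

namespace Literature.MathematicalPhysics.QuantumFieldTheory.Balaban1983to89.B11GlobalMin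

open Set

variable {Cfg : Type*} {E : Type*} [AddCommGroup E] [TopologicalSpace E] [Module ℝ E]
  [IsTopologicalAddGroup E] [ContinuousSMul ℝ E]

/-- COVERAGE of the space (6) by the chart (in print: p. 280–281 via [6] Thm 2, + Prop. 3 p. 289): every
configuration `U ∈ S6` has a chart point `A′ ∈ K` with the same action, `𝔉 A′ = 𝓐 U` ((74): 𝔉(A′) =
A(e^{iη(A′ − HD(A′))}U₀), gauge invariance of A).
[cite: Balaban1985Variational, pp.280–281 (18)–(21), Prop. 2; Prop. 3 p.289; (113)–(114) p.294; (74) p.289] -/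
def ChartCovers (S6 : Set Cfg) (𝓐 : Cfg → ℝ) (K : Set E) (𝔉 : E → ℝ) : Prop :=
  ∀ U ∈ S6, ∃ A' ∈ K, 𝔉 A' = 𝓐 U

/-- THE MISSING LEMMA as a hypothesis (LOCATED; printed nowhere): 𝔉 of (74)/(81) is convex on the convex chart
K = {(75), (76), (77)}.  Informal sufficient condition (GLOBAL-MIN.md (ML)): the volume-independent L²-form Hessian
bound for V on K against the L² gap and gradient form of Δ₁ on T = {Q𝔄 = 0, RD*𝔄 = 0}.  NOT implied by the block-sup
bounds (186), (189). [cite: Balaban1985Variational, (81) p.290, (142) p.299, (186) p.308] -/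
def ChartConvex (K : Set E) (𝔉 : E → ℝ) : Prop :=
  ConvexOn ℝ K 𝔉

/-- p. 299, (142) and the sentence after it: A′₀ (= 0 in the chart re-centred at U_k) is a local minimum of 𝔉 on K
(positive-definite second differential ⇒ strict local minimum; positivity = [5] Thm 3.11, GAPS G-B11-E5R).  Typed as
Mathlib's `IsLocalMinOn`. [cite: Balaban1985Variational, (141)–(142) p.299] [cite: Balaban1985BackgroundPropagators, Thm 3.11 p.416] -/
def LocalMinOnChart (K : Set E) (𝔉 : E → ℝ) (A₀ : E) : Prop :=
  IsLocalMinOn 𝔉 K A₀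

/-- (b) of the located reduction: on the chart, local minimum + convexity ⇒ global minimum over the whole chart.
[folklore] (Mathlib `IsMinOn.of_isLocalMinOn_of_convexOn`) -/
theorem globalMin_on_chart {K : Set E} {𝔉 : E → ℝ} {A₀ : E} (hA₀ : A₀ ∈ K)
    (hloc : LocalMinOnChart K 𝔉 A₀) (hconv : ChartConvex K 𝔉) : IsMinOn 𝔉 K A₀ :=
  IsMinOn.of_isLocalMinOn_of_convexOn hA₀ hloc hconv

/-- **The located reduction in one statement.**  GIVEN the printed coverage (a) (`ChartCovers`), the printed local
minimum (p. 299) at the chart point `A₀` of U_k with `𝔉 A₀ = 𝓐 Uk`, AND the unprinted convexity lemma (c)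
(`ChartConvex`), U_k minimises the action over the WHOLE space (6): `𝓐 Uk ≤ 𝓐 U` for every `U ∈ S6` — the reading of
Theorem 1's «minimal orbit in the space (8)» ((8) ⊆ (6)) and of the abstract's «there exists a minimum of this
action».  Without (c) the paper proves the local statement only (D-B11-2).
[cite: Balaban1985Variational, Thm 1 (8) p.279; pp.280–281; Prop. 3 p.289; (142) p.299] -/
theorem globalMin_of_chart {S6 : Set Cfg} {𝓐 : Cfg → ℝ} {K : Set E} {𝔉 : E → ℝ} {A₀ : E} {Uk : Cfg}
    (hcov : ChartCovers S6 𝓐 K 𝔉) (hA₀ : A₀ ∈ K) (hUk : 𝔉 A₀ = 𝓐 Uk)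
    (hloc : LocalMinOnChart K 𝔉 A₀) (hconv : ChartConvex K 𝔉) :
    ∀ U ∈ S6, 𝓐 Uk ≤ 𝓐 U := by
  intro U hU
  obtain ⟨A', hA'K, hA'⟩ := hcov U hU
  have hmin := globalMin_on_chart hA₀ hloc hconv
  rw [← hUk, ← hA']
  exact hmin hA'K

/-- The same with (8) ⊆ (6) made explicit: minimality over the smaller regular space (8) — what the consumers use
(cell GAPS C-adv7-6 (L1): *"minimality of U_{k+1}(W) IN (8)_{k+1}"*) — is the restriction of the global statement;
it is NOT delivered by the p. 299 local statement alone either (the neighbourhood of the strict local minimum is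
unquantified, the radius B₃ε₁ of (8) is fixed). [cite: Balaban1985Variational, Thm 1 (8) p.279] -/
theorem globalMin_on_space8 {S6 S8 : Set Cfg} {𝓐 : Cfg → ℝ} {K : Set E} {𝔉 : E → ℝ} {A₀ : E} {Uk : Cfg}
    (h86 : S8 ⊆ S6) (hcov : ChartCovers S6 𝓐 K 𝔉) (hA₀ : A₀ ∈ K) (hUk : 𝔉 A₀ = 𝓐 Uk)
    (hloc : LocalMinOnChart K 𝔉 A₀) (hconv : ChartConvex K 𝔉) :
    ∀ U ∈ S8, 𝓐 Uk ≤ 𝓐 U :=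
  fun U hU => globalMin_of_chart hcov hA₀ hUk hloc hconv U (h86 hU)

omit [TopologicalSpace E] [IsTopologicalAddGroup E] [ContinuousSMul ℝ E] in
/-- Convexity of the chart itself (used implicitly by `ConvexOn`; recorded because it IS checkable from print): an
intersection of an affine constraint set ((75): L^jηQ_jA′ = B), a linear one ((76): RD*A′ = 0) and sup-norm balls
((77)) is convex.  Abstractly: the intersection of a family of convex sets is convex. [folklore] -/
theorem chart_convex_of_pieces {ι : Type*} (P : ι → Set E) (hP : ∀ i, Convex ℝ (P i)) :
    Convex ℝ (⋂ i, P i) :=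
  convex_iInter hP

omit [TopologicalSpace E] [IsTopologicalAddGroup E] [ContinuousSMul ℝ E] in
/-- A sup-norm ball of a seminorm-like functional is convex — the shape of each condition in (77)
(|A′| < ε₃(L^jη)^{−1}, |∇A′| < ε₃(L^jη)^{−2}, …): for a real-linear map `ℓ` into a seminormed space and a radius `r`,
`{A | ‖ℓ A‖ < r}` is convex. [folklore] -/
theorem normBall_preimage_convex {F : Type*} [SeminormedAddCommGroup F] [NormedSpace ℝ F]
    (ℓ : E →ₗ[ℝ] F) (r : ℝ) : Convex ℝ {A : E | ‖ℓ A‖ < r} := by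
  have : {A : E | ‖ℓ A‖ < r} = ℓ ⁻¹' Metric.ball (0 : F) r := by
    ext A; simp [Metric.mem_ball, dist_zero_right]
  rw [this]
  exact (convex_ball (0 : F) r).linear_preimage ℓ

end Literature.MathematicalPhysics.QuantumFieldTheory.Balaban1983to89.B11GlobalMin
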